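import Mathlib
import HarnessLib
import Literature.Geometry.Lorentzian.KerrSchild
import Literature.Geometry.Lorentzian.KerrWaveDecay
import Literature.Geometry.Lorentzian.KerrConvergence
import Literature.Geometry.Lorentzian.KerrConvergenceProofs
import Literature.Geometry.Lorentzian.BoostedKerrSchildDecay
import Literature.Geometry.Lorentzian.MultiCentreKerrSchild
import Literature.Geometry.Lorentzian.KerrSchildChartCovariance
import Literature.Geometry.Lorentzian.KerrDeSitterData
import Literature.Geometry.Lorentzian.KerrFluxComparison
import Summits.FinalStateConjecture.FinalStateConjecture.Statement

/-!
# Stub `stub_settledRechart` of the line `registered` of crux `LogTimeThreeAnnuli.DyadicCapture`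
# (stmt-FinalStateConjecture-17488): a settled `C²` system is the Statement's conclusion

Given an MGHD `𝒟` and a `C²` final-state decomposition `d'` of `O' ⊆ 𝒟.carrier` with sub-extremal
holes, `O' = exteriorOf 𝒟 d'.charted`, rays staying in `closure O'`, exhaustive charts, orthochronous
motions, the COVECTOR orientation clause (eventually in chart time, every `w` whose push-forward
`dΨᵢ w` is `g`-future-directed at a point of the truncated slab `{t*ᵢ = τ, rᵢ ≤ ρ}` has
`(Λᵢ⁻¹ w)⁰ > 0`) and the flat `∂₀` clause, the same pair `(O', d')` witnesses the settling conjunct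
of the Statement; the only thing to prove is clause (ii) of
`Summit.FinalStateConjecture.IsFutureOriented d'`: eventually the push-forward
`U = dΨᵢ (Λᵢ V_{Mᵢ,aᵢ}(Λᵢ⁻¹(x − cᵢ)))` of the boosted background's time vector
`V = −g♯(dt*) = ∂_{t*} − 2H ℓ♯` (`Kerr.timeVector`) is future-directed.

Mechanism (O'Neill 1983, Ch. 5, pp. 140–145; Dafermos–Rodnianski arXiv:0811.0354, §5.1;
Visser arXiv:0706.0622, (32)–(35)).  On the sub-extremal exterior `0 ≤ H ≤ M/r ≤ M/r₊ ≤ 1`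
and `|ℓ⃗| = 1`, so `‖V‖² = (1 + 2H)² + 4H² ≤ 13` uniformly; with `u = Λ V`,
`g_{M,a}(V, V) = −1 − 2H` (`Kerr.bilin_timeVector_timeVector`) is the background value
`boostedKerrBilin(u, u)`.  The `C⁰` part of the `C²` deviation on the truncated slab is
eventually `≤ δ` with `13 ‖Λ‖² δ < 1`, whence `g(U, U) ≤ −1 − 2H + 13 ‖Λ‖² δ < 0`: `U` is
timelike, hence future- or past-directed.  If it were past-directed, `−U = dΨ(−u)` would be
future-directed and the covector clause would give `0 < (Λ⁻¹(−u))⁰ = −V⁰ = −(1 + 2H) < 0`.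
-/

-- the `Summit.FinalStateConjecture.FinalStateConjecture.…` namespace repeats the summit = sub-problem segment (D-0017); deliberate.
set_option linter.dupNamespace false

noncomputable section

namespace Summit.FinalStateConjecture.FinalStateConjecture.Theorems

open Literature.Geometry.Lorentzian
open scoped Topology Manifold ENNReal ContDiff
open Filter Set

/-- `‖V‖² = (1 + 2H)² + 4H²` (Euclidean coordinate norm) wherever `r > 0`, since
`V = (1 + 2H, −2H ℓ⃗)` with `|ℓ⃗| = 1`. Visser arXiv:0706.0622, (34)–(35).
[cite: arXiv07060622, (34)–(35)] -/
theorem dyadicCapture_norm_timeVector_sq {M a : ℝ} {z : E4} (hz : 0 < Kerr.radius a z) :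
    ‖Kerr.timeVector M a z‖ ^ 2 =
      (1 + 2 * Kerr.scalarH M a z) ^ 2 + 4 * Kerr.scalarH M a z ^ 2 := by
  have hs := Kerr.sum_sq_nullCovectorFun hz
  rw [EuclideanSpace.real_norm_sq_eq, Fin.sum_univ_four]
  simp [Kerr.timeVector]
  linear_combination (4 * Kerr.scalarH M a z ^ 2) * hs

/-- Uniform bound `‖V_{M,a}(z)‖² ≤ 13` on the sub-extremal exterior: `0 ≤ H ≤ 1` there
(`Kerr.scalarH_nonneg`, `Kerr.scalarH_le_one`: `H ≤ M/r ≤ M/r₊ ≤ 1`) and `|ℓ⃗| = 1`.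
Visser arXiv:0706.0622, (33)–(35). [cite: arXiv07060622, (33)–(35)] -/
theorem dyadicCapture_norm_timeVector_sq_le {M a : ℝ} (hMa : Kerr.IsSubextremal M a) {z : E4}
    (hz : z ∈ Kerr.exterior M a) : ‖Kerr.timeVector M a z‖ ^ 2 ≤ 13 := by
  have hH0 := Kerr.scalarH_nonneg hMa.pos.le a z
  have hH1 : Kerr.scalarH M a z ≤ 1 := Kerr.scalarH_le_one hMa hz
  rw [dyadicCapture_norm_timeVector_sq (Kerr.radius_pos_of_mem_region hz)]
  nlinarith

/-- **`C⁰` control of the pulled-back metric on a truncated slab.** If the `C⁰` deviation of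
`Ψ^* g` from the background `B` on `{t = τ, r ≤ ρ}` is at most `δ`, then at every point `x` of
that slab `|g(dΨ u, dΨ v) − g₀(x)(u, v)| ≤ δ ‖u‖ ‖v‖` (operator norm of the order-`0` term of
`supCkENorm`). DHRT arXiv:2104.08222, §1. [cite: arXiv210408222, §1] -/
theorem dyadicCapture_abs_pullback_sub_bilin_le {𝓢 : Spacetime 4} (B : ModelBackground)
    (Ψ : B.domain → 𝓢.carrier) {ρ τ δ : ℝ} (hδ : 0 ≤ δ)
    (h : 𝓢.truncDeviationCk B Ψ 0 ρ τ ≤ ENNReal.ofReal δ) {x : B.domain}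
    (hx : x ∈ B.truncTimeSlab ρ τ) (u v : E4) :
    |𝓢.metric.val (Ψ x) (mfderiv 𝓘(ℝ, E4) (𝓡 4) Ψ x u) (mfderiv 𝓘(ℝ, E4) (𝓡 4) Ψ x v) -
        B.bilin (x : E4) u v| ≤ δ * ‖u‖ * ‖v‖ := by
  -- adapted from `abs_pullback_sub_bilin_le`
  -- (Theorems/LogTimeThreeAnnuliSubconvergentEraGenericStubOrientationGaugeAbsorption.lean)
  have h1 : ‖iteratedFDeriv ℝ 0 (𝓢.deviationExtend B Ψ) (x : E4)‖ₑ ≤ ENNReal.ofReal δ :=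
    (enorm_iteratedFDeriv_le_supCkENorm (le_refl 0) (Set.mem_image_of_mem Subtype.val hx) _).trans h
  rw [← ofReal_norm, ENNReal.ofReal_le_ofReal_iff hδ, norm_iteratedFDeriv_zero,
    Spacetime.deviationExtend_coe] at h1
  have h2 := (𝓢.deviation B Ψ x).le_opNorm₂ u v
  rw [Spacetime.deviation_apply, Real.norm_eq_abs] at h2
  calc _ ≤ ‖𝓢.deviation B Ψ x‖ * ‖u‖ * ‖v‖ := h2
    _ ≤ δ * ‖u‖ * ‖v‖ := by gcongr

/-- **Pointwise future-directedness of the transported time vector.** On the boosted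
sub-extremal Kerr background with chart map `Ψ`, at a point `x` of the truncated slab
`{t* = τ, r ≤ ρ}` where `Ψ^* g` is `δ`-close in `C⁰` to `boostedKerrBilin` with
`13 ‖Λ‖² δ < 1`, and where every `w` with future-directed push-forward has `(Λ⁻¹ w)⁰ > 0`, the
push-forward of `u = Λ V_{M,a}(Λ⁻¹(x − c))` is future-directed: `g(dΨ u, dΨ u) ≤
−1 − 2H + 13 ‖Λ‖² δ < 0` makes it timelike, and past-directedness would give
`0 < (Λ⁻¹(−u))⁰ = −(1 + 2H)`. O'Neill 1983, Ch. 5, p. 145; Dafermos–Rodnianski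
arXiv:0811.0354, §5.1. [cite: ONeill1983, Ch. 5  p. 145] [cite: arXiv08110354, §5.1] -/
theorem dyadicCapture_isFutureDirected_pushforward {𝓢 : Spacetime 4} (Λ : lorentzGroup)
    (c : E4) {M a : ℝ} (hMa : Kerr.IsSubextremal M a)
    (Ψ : (boostedKerrBackground Λ c M a).domain → 𝓢.carrier) {ρ τ δ : ℝ} (hδ : 0 ≤ δ)
    (hδΛ : 13 * ‖((Λ : E4 ≃L[ℝ] E4) : E4 →L[ℝ] E4)‖ ^ 2 * δ < 1)
    (h : 𝓢.truncDeviationCk (boostedKerrBackground Λ c M a) Ψ 0 ρ τ ≤ ENNReal.ofReal δ)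
    {x : (boostedKerrBackground Λ c M a).domain}
    (hx : x ∈ (boostedKerrBackground Λ c M a).truncTimeSlab ρ τ)
    (hcov : ∀ w : E4, 𝓢.timeOrientation.IsFutureDirected (mfderiv 𝓘(ℝ, E4) (𝓡 4) Ψ x w) →
      0 < (Λ : E4 ≃L[ℝ] E4).symm w 0) :
    𝓢.timeOrientation.IsFutureDirected (mfderiv 𝓘(ℝ, E4) (𝓡 4) Ψ x
      ((Λ : E4 ≃L[ℝ] E4) (Kerr.timeVector M a (poincareInv Λ c (x : E4))))) := by
  set z : E4 := poincareInv Λ c (x : E4) with hz_def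
  have hz : z ∈ Kerr.exterior M a := mem_boostedKerrExterior.1 x.2
  have hr0 : 0 < Kerr.radius a z := Kerr.radius_pos_of_mem_region hz
  have hH0 : 0 ≤ Kerr.scalarH M a z := Kerr.scalarH_nonneg hMa.pos.le a z
  set V : E4 := Kerr.timeVector M a z with hV_def
  set u : E4 := (Λ : E4 ≃L[ℝ] E4) V with hu_def
  -- the background value `boostedKerrBilin(u, u) = g_{M,a}(V, V) = -1 - 2H`
  have hB : (boostedKerrBackground Λ c M a).bilin (x : E4) u u = -1 - 2 * Kerr.scalarH M a z := by
    change boostedKerrBilin Λ c M a (x : E4) u u = _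
    rw [boostedKerrBilin_apply, hu_def, ContinuousLinearEquiv.symm_apply_apply]
    exact Kerr.bilin_timeVector_timeVector hr0
  -- the uniform norm bound `‖u‖² ≤ 13 ‖Λ‖²`
  have hu_norm : ‖u‖ ^ 2 ≤ 13 * ‖((Λ : E4 ≃L[ℝ] E4) : E4 →L[ℝ] E4)‖ ^ 2 := by
    have h1 : ‖u‖ ≤ ‖((Λ : E4 ≃L[ℝ] E4) : E4 →L[ℝ] E4)‖ * ‖V‖ :=
      ((Λ : E4 ≃L[ℝ] E4) : E4 →L[ℝ] E4).le_opNorm V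
    have h2 : ‖V‖ ^ 2 ≤ 13 := dyadicCapture_norm_timeVector_sq_le hMa hz
    calc ‖u‖ ^ 2 ≤ (‖((Λ : E4 ≃L[ℝ] E4) : E4 →L[ℝ] E4)‖ * ‖V‖) ^ 2 :=
          pow_le_pow_left₀ (norm_nonneg _) h1 2
      _ = ‖((Λ : E4 ≃L[ℝ] E4) : E4 →L[ℝ] E4)‖ ^ 2 * ‖V‖ ^ 2 := mul_pow _ _ 2
      _ ≤ ‖((Λ : E4 ≃L[ℝ] E4) : E4 →L[ℝ] E4)‖ ^ 2 * 13 :=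
          mul_le_mul_of_nonneg_left h2 (sq_nonneg _)
      _ = 13 * ‖((Λ : E4 ≃L[ℝ] E4) : E4 →L[ℝ] E4)‖ ^ 2 := mul_comm _ _
  -- the `C⁰` deviation bound at `x`
  have hdev := dyadicCapture_abs_pullback_sub_bilin_le _ Ψ hδ h hx u u
  rw [hB, abs_le] at hdev
  -- `dΨ u` is timelike
  have hneg : 𝓢.metric.val (Ψ x) (mfderiv 𝓘(ℝ, E4) (𝓡 4) Ψ x u)
      (mfderiv 𝓘(ℝ, E4) (𝓡 4) Ψ x u) < 0 := by
    have h3 : δ * ‖u‖ * ‖u‖ ≤ δ * (13 * ‖((Λ : E4 ≃L[ℝ] E4) : E4 →L[ℝ] E4)‖ ^ 2) := by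
      rw [mul_assoc, ← pow_two]
      exact mul_le_mul_of_nonneg_left hu_norm hδ
    nlinarith [hdev.2, hδΛ, hH0, h3]
  have hcausal : 𝓢.metric.IsCausal (mfderiv 𝓘(ℝ, E4) (𝓡 4) Ψ x u) :=
    (show 𝓢.metric.IsTimelike (mfderiv 𝓘(ℝ, E4) (𝓡 4) Ψ x u) from hneg).isCausal
  rcases 𝓢.timeOrientation.isFutureDirected_or_isPastDirected_of_isCausal hcausal with hf | hp
  · exact hf
  · exfalso
    have e : mfderiv 𝓘(ℝ, E4) (𝓡 4) Ψ x (-u) = -(mfderiv 𝓘(ℝ, E4) (𝓡 4) Ψ x u) :=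
      map_neg _ u
    have hf' : 𝓢.timeOrientation.IsFutureDirected (mfderiv 𝓘(ℝ, E4) (𝓡 4) Ψ x (-u)) := by
      rw [e]
      exact (𝓢.timeOrientation.isFutureDirected_neg_iff _).2 hp
    have h4 := hcov (-u) hf'
    rw [hu_def, map_neg, ContinuousLinearEquiv.symm_apply_apply] at h4
    have hV0 : V 0 = 1 + 2 * Kerr.scalarH M a z := Kerr.timeVector_apply_zero M a z
    have h5 : (-V) 0 = -(V 0) := rfl
    rw [h5, hV0] at h4
    linarith

/-- **Eventual future-directedness of the transported time vector on truncated slabs.** If the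
`Cᵏ` deviation of `Ψ^* g` from boosted sub-extremal Kerr on `{t* = τ, r ≤ ρ}` tends to `0` and
the covector orientation clause holds eventually on these slabs, then eventually the push-forward
of `Λ V_{M,a}(Λ⁻¹(x − c))` is future-directed at every point of the slab (choose
`δ = 1/(13 ‖Λ‖² + 14)` and apply `dyadicCapture_isFutureDirected_pushforward`).
O'Neill 1983, Ch. 5, p. 145; Dafermos–Rodnianski arXiv:0811.0354, §5.1.
[cite: ONeill1983, Ch. 5  p. 145] [cite: arXiv08110354, §5.1] -/
theorem dyadicCapture_eventually_isFutureDirected {𝓢 : Spacetime 4} (Λ : lorentzGroup) (c : E4)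
    {M a : ℝ} (hMa : Kerr.IsSubextremal M a)
    (Ψ : (boostedKerrBackground Λ c M a).domain → 𝓢.carrier) {k : ℕ} (ρ : ℝ)
    (hconv : Tendsto (fun τ ↦ 𝓢.truncDeviationCk (boostedKerrBackground Λ c M a) Ψ k ρ τ)
      atTop (𝓝 0))
    (hcov : ∀ᶠ τ in atTop, ∀ x ∈ (boostedKerrBackground Λ c M a).truncTimeSlab ρ τ, ∀ w : E4,
      𝓢.timeOrientation.IsFutureDirected (mfderiv 𝓘(ℝ, E4) (𝓡 4) Ψ x w) →
        0 < (Λ : E4 ≃L[ℝ] E4).symm w 0) :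
    ∀ᶠ τ in atTop, ∀ x ∈ (boostedKerrBackground Λ c M a).truncTimeSlab ρ τ,
      𝓢.timeOrientation.IsFutureDirected (mfderiv 𝓘(ℝ, E4) (𝓡 4) Ψ x
        ((Λ : E4 ≃L[ℝ] E4) (Kerr.timeVector M a (poincareInv Λ c (x : E4))))) := by
  set K : ℝ := ‖((Λ : E4 ≃L[ℝ] E4) : E4 →L[ℝ] E4)‖ ^ 2 with hK_def
  have hK : 0 ≤ K := sq_nonneg _
  set δ : ℝ := 1 / (13 * K + 14) with hδ_def
  have hδpos : 0 < δ := by positivity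
  have hδΛ : 13 * K * δ < 1 := by
    rw [hδ_def, mul_one_div, div_lt_one (by positivity)]
    linarith
  have hev : ∀ᶠ τ in atTop,
      𝓢.truncDeviationCk (boostedKerrBackground Λ c M a) Ψ k ρ τ ≤ ENNReal.ofReal δ :=
    ENNReal.tendsto_nhds_zero.1 hconv _ (ENNReal.ofReal_pos.2 hδpos)
  filter_upwards [hev, hcov] with τ hτ hcovτ x hx
  have h0 : 𝓢.truncDeviationCk (boostedKerrBackground Λ c M a) Ψ 0 ρ τ ≤
      𝓢.truncDeviationCk (boostedKerrBackground Λ c M a) Ψ k ρ τ :=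
    supCkENorm_mono_right _ (Nat.zero_le k) _
  exact dyadicCapture_isFutureDirected_pushforward Λ c hMa Ψ hδpos.le hδΛ (h0.trans hτ) hx
    (hcovτ x hx)

/-- **Stub `stub_settledRechart`** (line `registered` of crux `LogTimeThreeAnnuli.DyadicCapture`,
stmt-FinalStateConjecture-17488): a SETTLED `C²` system — sub-extremal holes, self-determined
exterior, rays in the closure, exhaustive charts, orthochronous motions, the covector orientation
clause on truncated Kerr–Schild slabs and the flat `∂₀` clause — is the Statement's settling
conjunct, with the same `(O', d')`; the vector form (ii) of `IsFutureOriented` follows from the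
covector clause and `C⁰` convergence by `dyadicCapture_eventually_isFutureDirected`.
Dafermos–Luk arXiv:1710.01722, Conjecture 1 (b)–(c); O'Neill 1983, Ch. 5, p. 145;
Dafermos–Rodnianski arXiv:0811.0354, §5.1. [cite: DafermosLuk2017, Conjecture 1 (b)–(c)]
[cite: arXiv08110354, §5.1] -/
theorem stub_settledRechart : ∀ (X : Type) [TopologicalSpace X] [ChartedSpace E3 X] [IsManifold (𝓡 3) ((⊤ : ℕ∞) : WithTop ℕ∞) X] [T2Space X] [SecondCountableTopology X] [ConnectedSpace X], ∀ D ∈ admissibleVacuumData X, ∀ 𝒟 : VacuumCauchyDevelopment D, 𝒟.IsMaximal → Summit.FinalStateConjecture.HasCompleteNullInfinity 𝒟.toCauchyDevelopment → ∀ (O' : Set 𝒟.carrier) (d' : FinalStateDecomposition 𝒟.toSpacetime O' 2), (∀ i, Kerr.IsSubextremal (d'.mass i) (d'.spin i)) → O' = Summit.FinalStateConjecture.exteriorOf 𝒟.toCauchyDevelopment d'.charted → Summit.FinalStateConjecture.RaysStayInClosure 𝒟.toCauchyDevelopment O' → Summit.FinalStateConjecture.HasExhaustiveCharts d' → (∀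 i : Fin d'.N, Summit.FinalStateConjecture.IsOrthochronous (d'.motion i).1) → (∀ (i : Fin d'.N) (ρ : ℝ), ∀ᶠ τ in Filter.atTop, ∀ x ∈ (d'.background i).truncTimeSlab ρ τ, ∀ w : E4, 𝒟.timeOrientation.IsFutureDirected (mfderiv 𝓘(ℝ, E4) (𝓡 4) (d'.chart i) x w) → 0 < ((d'.motion i).1 : E4 ≃L[ℝ] E4).symm w 0) → (∀ᶠ τ in Filter.atTop, ∀ x ∈ (Minkowski.backgroundOn d'.flatDomain).timeSlab τ, 𝒟.timeOrientation.IsFutureDirected (mfderiv 𝓘(ℝ, E4) (𝓡 4) d'.flatChart x (E4.basisVector 0))) → ∃ (O' : Set 𝒟.carrier) (d' : FinalStateDecomposition 𝒟.toSpacetime O' 2), (∀ i, Kerr.IsSubextremal (d'.mass i) (d'.spin i)) ∧ O' = Summit.FinalStateConjecture.exteriorOf 𝒟.toCauchyDevelopment d'.charted ∧ Summit.FinalStateConjecture.RaysStayInClosure 𝒟.toCauchyDevelopment O' ∧ Summit.FinalStateConjecture.HasExhaustiveCharts d' ∧ Summit.FinalStateConjecture.IsFutureOriented d' := by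
  intro X _ _ _ _ _ _ D _hD 𝒟 _hmax _hI O' d' h1 h2 h3 h4 h5 h6 h7
  refine ⟨O', d', h1, h2, h3, h4, h5, fun i ρ ↦ ?_, h7⟩
  exact dyadicCapture_eventually_isFutureDirected (d'.motion i).1 (d'.motion i).2 (h1 i)
    (d'.chart i) ρ (d'.tendsto_truncDeviationCk i ρ) (h6 i ρ)

end Summit.FinalStateConjecture.FinalStateConjecture.Theorems

end
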